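import Summits.FinalStateConjecture.FinalStateConjecture.Theses.HomotheticSurfaceGravity
import Summits.FinalStateConjecture.FinalStateConjecture.Theorems.CurvatureOrSymmetryMinimalSingularTipChains

/-!
# Route HomotheticSurfaceGravity — typed decomposition of the crux `NakedTangentProfile`
(stmt-FinalStateConjecture-17353; crux-strategist, BC2 redirect)

The crux `NakedTangentProfile` (an admissible datum with a maximal vacuum Cauchy development of
incomplete sojourn-`𝓘⁺` either exits locally through tame immersed good data, or that development
has a FIRST NAKED POINT carrying a NONFLAT smooth self-similar vacuum `C²` tangent profile) is the
conjunction of the two steps of the tangent-profile programme — Step 1 "a first naked ideal point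
exists" and Step 2 "blow up there". This file proves that it follows from THREE typed pieces, cut
along the seams where the mathematics changes character:

* **(A) `VisibleEndlessObserver`** — LOCALISATION OF THE INCOMPLETENESS AT AN OBSERVER: if `𝓘⁺` is
  incomplete then (exit, or) some future-endless timelike curve `γ₀` — an observer falling into
  the singular future boundary — has its whole world-line `γ₀(s₀)` seen by the bounded-sojourn
  incomplete far rays that witness the incompleteness (`IsVisibleFromInfinity`). Geometric input:
  exterior stability localises the witnessing rays' ends, whose pasts share an observer.
* **(B) `NoTIPCascade`** — NO ZENO CASCADE OF VISIBLE IDEAL POINTS: inside a visible terminal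
  indecomposable past set `W₀`, below every antitone sequence of TIPs runs a future-endless
  timelike curve (or exit). Input: Cauchy stability (ideal points cannot accumulate at an interior
  event) and the data hypersurface / sojourn bounds (vertices cannot recede to `Σ` or to infinity).
* **(C) `ProfileAtFirstNakedPoint`** — BLOW-UP AT EVERY FIRST NAKED POINT: at every first naked
  point of a maximal development of admissible data, exit or a nonflat smooth self-similar vacuum
  `C²` tangent profile (scale-critical compactness, Type-II exclusion, non-flatness by
  `ε`-regularity, regularity of the limit across its cone).

The assembly `nakedTangentProfile_of_subs : A → B → C → NakedTangentProfile` is not a re-bracketing: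
between (A), (B) and (C) sit (i) "the chronological past of a visible set is visible" (pasts are
past sets), (ii) "a future-endless timelike curve generates a TIP containing every TIP-past it
threads" (`IsTIP` by definition, `IsTIP.isPastSet`, monotonicity of `I⁻`), (iii) the landed
order-theoretic reduction `cauchyDevelopment_exists_isMinimalTIP_subset_of_seq` (Zorn on TIPs
ordered by `⊇` plus countable coinitiality of chains of open sets in the second-countable carrier:
a visible TIP with no cascade contains a `⊆`-minimal TIP), (iv) antitonicity of visibility, which
makes that minimal TIP a first naked point (`IsMinimalTIP.isFirstNakedPoint`) under the
development's Levi-Civita binder, and (v) the dispatch of (C) at that point. Pure causal/order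
theory over `IdealPoints.lean`; no named Literature fact enters the import cone.
-/

set_option linter.dupNamespace false

namespace Summit.FinalStateConjecture.FinalStateConjecture.Theorems

open Set Filter Function
open scoped Manifold ContDiff Topology
open Literature.Geometry.Lorentzian
open Summit.FinalStateConjecture.FinalStateConjecture.Theses.HomotheticSurfaceGravity

section Visibility

variable {E : Type*} [NormedAddCommGroup E] [NormedSpace ℝ E] {H : Type*} [TopologicalSpace H]
  {I : ModelWithCorners ℝ E H} {M : Type*} [TopologicalSpace M] [ChartedSpace H M]
  [IsManifold I ∞ M] {X : Type*} [TopologicalSpace X] {g : LorentzianMetric I ∞ M}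
  {τ : TimeOrientation g} {ι : X → M} [FiniteDimensional ℝ E] [CompleteSpace E] [g.HasLeviCivita]
  {N : NormalField I ι}

omit [CompleteSpace E] in
/-- **The chronological past of a set visible from infinity is visible from infinity**: if every
witnessing far ray `γ` has `P ⊆ I⁻(γ⁺)`, then `I⁻(P) ⊆ I⁻(I⁻(γ⁺)) ⊆ I⁻(γ⁺)` because chronological
pasts are past sets (Hawking–Ellis 1973, §6.8, p. 217). -/
theorem isVisibleFromInfinity_chronologicalPast {P : Set M}
    (h : g.IsVisibleFromInfinity τ ι N P) :
    g.IsVisibleFromInfinity τ ι N (g.chronologicalPast τ P) := by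
  intro B₀ hB₀
  obtain ⟨s, hs⟩ := h B₀ hB₀
  refine ⟨s, fun B₁ hB₁ ↦ ?_⟩
  obtain ⟨p, hp, γ, dom, hγ, hbdd, hsoj, hsub⟩ := hs B₁ hB₁
  exact ⟨p, hp, γ, dom, hγ, hbdd, hsoj,
    (LorentzianMetric.chronologicalPast_mono hsub).trans
      (LorentzianMetric.isPastSet_chronologicalPast _)⟩

end Visibility

section TIP

variable {E : Type*} [NormedAddCommGroup E] [NormedSpace ℝ E] {H : Type*} [TopologicalSpace H]
  {I : ModelWithCorners ℝ E H} {n : ℕ∞ω} {M : Type*} [TopologicalSpace M] [ChartedSpace H M]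
  [IsManifold I ∞ M] {g : LorentzianMetric I n M} {τ : TimeOrientation g}

/-- **A future-endless timelike curve threading a family of TIPs generates a TIP below all of
them**: `I⁻(γ(s))` is a TIP by definition (Geroch–Kronheimer–Penrose; Hawking–Ellis 1973, §6.8,
Prop. 6.8.1), and `γ(s) ⊆ Pₖ` gives `I⁻(γ(s)) ⊆ I⁻(Pₖ) ⊆ Pₖ` since a TIP is a past set. -/
theorem exists_isTIP_subset_of_isFutureEndless {κ : Sort*} {P : κ → Set M}
    (hP : ∀ k, g.IsTIP τ (P k)) {γ : ℝ → M} {s : Set ℝ} (hs : s.OrdConnected)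
    (hγ : g.IsFutureTimelikeCurveOn τ γ s) (he : IsFutureEndless γ s) (hsub : ∀ k, γ '' s ⊆ P k) :
    ∃ W, g.IsTIP τ W ∧ ∀ k, W ⊆ P k :=
  ⟨g.chronologicalPast τ (γ '' s), ⟨γ, s, hs, hγ, he, rfl⟩, fun k ↦
    (LorentzianMetric.chronologicalPast_mono (hsub k)).trans (hP k).isPastSet⟩

end TIP

/-- **Typed decomposition of `NakedTangentProfile`** (route HomotheticSurfaceGravity, crux
stmt-FinalStateConjecture-17353): localisation of the incompleteness at a visible endless observer
(A), absence of a Zeno cascade of visible ideal points (B) and blow-up at every first naked point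
(C) imply the crux. Proof: fix an admissible `D` and a maximal development `𝒟` with incomplete
`𝓘⁺`, and suppose `D` does not exit (otherwise done). (A) gives a future-endless timelike `γ₀`
whose image is visible; `W₀ := I⁻(γ₀(s₀))` is then a TIP (by definition) which is visible
(`isVisibleFromInfinity_chronologicalPast`). For every antitone sequence of TIPs inside `W₀`, (B)
gives an endless timelike curve threading it, hence a TIP below it
(`exists_isTIP_subset_of_isFutureEndless`); so the landed Zorn/second-countability reduction
`cauchyDevelopment_exists_isMinimalTIP_subset_of_seq` yields a `⊆`-minimal TIP `W ⊆ W₀`, visible by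
antitonicity, i.e. a first naked point of `𝒟` (for the — proof-irrelevant — Levi-Civita instance
of the smooth metric, `hasLeviCivita`). (C) at `W` gives the nonflat smooth self-similar tangent
profile. -/
theorem nakedTangentProfile_of_subs
    (hA : ∀ (X : Type) [TopologicalSpace X] [ChartedSpace Literature.Geometry.Lorentzian.E3 X] [IsManifold (𝓡 3) ((⊤ : ℕ∞) : WithTop ℕ∞) X] [T2Space X] [SecondCountableTopology X] [ConnectedSpace X], ∀ D ∈ Literature.Geometry.Lorentzian.admissibleVacuumData X, ∀ 𝒟 : Literature.Geometry.Lorentzian.VacuumCauchyDevelopment D, 𝒟.IsMaximal → ¬ Summit.FinalStateConjecture.HasCompleteNullInfinity 𝒟.toCauchyDevelopment → (∃ (e : Literature.Geometry.Lorentzian.AFEnd X) (F : EuclideanSpace ℝ (Fin 1) → Literature.Geometry.Lorentzian.InitialDataSet (𝓡 3) X), Literature.Geometry.Lorentzian.InitialDataSet.IsTameDataFamily e 1 F ∧ Literature.Geometry.Lorentzian.InitialDataSet.IsImmersedAtZero 1 F ∧ F 0 = D ∧ Function.Injective F ∧ (∀ c, F c ∈ Literature.Geometry.Lorentzian.admissibleVacuumData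 X) ∧ ∃ ε : ℝ, 0 < ε ∧ ∀ c, c ≠ 0 → ‖c‖ < ε → ((∃ 𝒟' : Literature.Geometry.Lorentzian.VacuumCauchyDevelopment (F c), 𝒟'.IsMaximal) ∧ ∀ 𝒟' : Literature.Geometry.Lorentzian.VacuumCauchyDevelopment (F c), 𝒟'.IsMaximal → Summit.FinalStateConjecture.HasCompleteNullInfinity 𝒟'.toCauchyDevelopment ∧ ∃ (O : Set 𝒟'.carrier) (d : Literature.Geometry.Lorentzian.FinalStateDecomposition 𝒟'.toSpacetime O 2), (∀ i, Literature.Geometry.Lorentzian.Kerr.IsSubextremal (d.mass i) (d.spin i)) ∧ O = Summit.FinalStateConjecture.exteriorOf 𝒟'.toCauchyDevelopment d.charted ∧ Summit.FinalStateConjecture.RaysStayInClosure 𝒟'.toCauchyDevelopment O ∧ Summit.FinalStateConjecture.HasExhaustiveCharts d ∧ Summit.FinalStateConjecture.IsFutureOriented d)) ∨ ∃ (γ₀ : ℝ → 𝒟.carrier) (s₀ : Set ℝ), s₀.OrdConnected ∧ 𝒟.metric.IsFutureTimelikeCurveOn 𝒟.timeOrientation γ₀ s₀ ∧ Literature.Geometry.Lorentzian.IsFutureEndless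 γ₀ s₀ ∧ ∀ [𝒟.metric.HasLeviCivita], 𝒟.metric.IsVisibleFromInfinity 𝒟.timeOrientation 𝒟.embed 𝒟.normal (γ₀ '' s₀))
    (hB : ∀ (X : Type) [TopologicalSpace X] [ChartedSpace Literature.Geometry.Lorentzian.E3 X] [IsManifold (𝓡 3) ((⊤ : ℕ∞) : WithTop ℕ∞) X] [T2Space X] [SecondCountableTopology X] [ConnectedSpace X], ∀ D ∈ Literature.Geometry.Lorentzian.admissibleVacuumData X, ∀ 𝒟 : Literature.Geometry.Lorentzian.VacuumCauchyDevelopment D, 𝒟.IsMaximal → ∀ W₀ : Set 𝒟.carrier, 𝒟.metric.IsTIP 𝒟.timeOrientation W₀ → (∀ [𝒟.metric.HasLeviCivita], 𝒟.metric.IsVisibleFromInfinity 𝒟.timeOrientation 𝒟.embed 𝒟.normal W₀) → ∀ P : ℕ → Set 𝒟.carrier, (∀ k, 𝒟.metric.IsTIP 𝒟.timeOrientation (P k)) → (∀ k, P k ⊆ W₀) → Antitone P → (∃ (e : Literature.Geometry.Lorentzian.AFEnd X) (F : EuclideanSpace ℝ (Fin 1) → Literature.Geometry.Lorentzian.InitialDataSet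 (𝓡 3) X), Literature.Geometry.Lorentzian.InitialDataSet.IsTameDataFamily e 1 F ∧ Literature.Geometry.Lorentzian.InitialDataSet.IsImmersedAtZero 1 F ∧ F 0 = D ∧ Function.Injective F ∧ (∀ c, F c ∈ Literature.Geometry.Lorentzian.admissibleVacuumData X) ∧ ∃ ε : ℝ, 0 < ε ∧ ∀ c, c ≠ 0 → ‖c‖ < ε → ((∃ 𝒟' : Literature.Geometry.Lorentzian.VacuumCauchyDevelopment (F c), 𝒟'.IsMaximal) ∧ ∀ 𝒟' : Literature.Geometry.Lorentzian.VacuumCauchyDevelopment (F c), 𝒟'.IsMaximal → Summit.FinalStateConjecture.HasCompleteNullInfinity 𝒟'.toCauchyDevelopment ∧ ∃ (O : Set 𝒟'.carrier) (d : Literature.Geometry.Lorentzian.FinalStateDecomposition 𝒟'.toSpacetime O 2), (∀ i, Literature.Geometry.Lorentzian.Kerr.IsSubextremal (d.mass i) (d.spin i)) ∧ O = Summit.FinalStateConjecture.exteriorOf 𝒟'.toCauchyDevelopment d.charted ∧ Summit.FinalStateConjecture.RaysStayInClosure 𝒟'.toCauchyDevelopment O ∧ Summit.FinalStateConjecture.HasExhaustiveCharts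 d ∧ Summit.FinalStateConjecture.IsFutureOriented d)) ∨ ∃ (γ : ℝ → 𝒟.carrier) (s : Set ℝ), s.OrdConnected ∧ 𝒟.metric.IsFutureTimelikeCurveOn 𝒟.timeOrientation γ s ∧ Literature.Geometry.Lorentzian.IsFutureEndless γ s ∧ ∀ k, γ '' s ⊆ P k)
    (hC : ∀ (X : Type) [TopologicalSpace X] [ChartedSpace Literature.Geometry.Lorentzian.E3 X] [IsManifold (𝓡 3) ((⊤ : ℕ∞) : WithTop ℕ∞) X] [T2Space X] [SecondCountableTopology X] [ConnectedSpace X], ∀ D ∈ Literature.Geometry.Lorentzian.admissibleVacuumData X, ∀ 𝒟 : Literature.Geometry.Lorentzian.VacuumCauchyDevelopment D, 𝒟.IsMaximal → ∀ P : Set 𝒟.carrier, 𝒟.toCauchyDevelopment.FirstNakedPoint P → (∃ (e : Literature.Geometry.Lorentzian.AFEnd X) (F : EuclideanSpace ℝ (Fin 1) → Literature.Geometry.Lorentzian.InitialDataSet (𝓡 3) X), Literature.Geometry.Lorentzian.InitialDataSet.IsTameDataFamily e 1 F ∧ Literature.Geometry.Lorentzian.InitialDataSet.IsImmersedAtZero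 1 F ∧ F 0 = D ∧ Function.Injective F ∧ (∀ c, F c ∈ Literature.Geometry.Lorentzian.admissibleVacuumData X) ∧ ∃ ε : ℝ, 0 < ε ∧ ∀ c, c ≠ 0 → ‖c‖ < ε → ((∃ 𝒟' : Literature.Geometry.Lorentzian.VacuumCauchyDevelopment (F c), 𝒟'.IsMaximal) ∧ ∀ 𝒟' : Literature.Geometry.Lorentzian.VacuumCauchyDevelopment (F c), 𝒟'.IsMaximal → Summit.FinalStateConjecture.HasCompleteNullInfinity 𝒟'.toCauchyDevelopment ∧ ∃ (O : Set 𝒟'.carrier) (d : Literature.Geometry.Lorentzian.FinalStateDecomposition 𝒟'.toSpacetime O 2), (∀ i, Literature.Geometry.Lorentzian.Kerr.IsSubextremal (d.mass i) (d.spin i)) ∧ O = Summit.FinalStateConjecture.exteriorOf 𝒟'.toCauchyDevelopment d.charted ∧ Summit.FinalStateConjecture.RaysStayInClosure 𝒟'.toCauchyDevelopment O ∧ Summit.FinalStateConjecture.HasExhaustiveCharts d ∧ Summit.FinalStateConjecture.IsFutureOriented d)) ∨ ∃ Z : Literature.Geometry.Lorentzian.SelfSimilarVacuumProfile.{0} ((⊤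 : ℕ∞) : WithTop ℕ∞), Z.IsNonflat ∧ Literature.Geometry.Lorentzian.Spacetime.IsTangentProfileAt 𝒟.toSpacetime P Z.toSpacetime Z.past 2) :
    NakedTangentProfile := by
  intro X _ _ _ _ _ _ D hD 𝒟 hmax hinc
  refine Classical.or_iff_not_imp_left.mpr fun hex ↦ ?_
  -- (A): a visible endless observer
  obtain ⟨γ₀, s₀, hs₀, hγ₀, he₀, hvis₀⟩ := (hA X D hD 𝒟 hmax hinc).resolve_left hex
  -- the Levi-Civita connection of the smooth metric exists; all instances are proof-irrelevant
  haveI hLC : 𝒟.metric.HasLeviCivita := 𝒟.metric.hasLeviCivita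
  -- `W₀ := I⁻(γ₀(s₀))` is a visible TIP
  set W₀ : Set 𝒟.carrier := 𝒟.metric.chronologicalPast 𝒟.timeOrientation (γ₀ '' s₀) with hW₀def
  have hW₀ : 𝒟.metric.IsTIP 𝒟.timeOrientation W₀ := ⟨γ₀, s₀, hs₀, hγ₀, he₀, rfl⟩
  have hW₀vis : ∀ [𝒟.metric.HasLeviCivita],
      𝒟.metric.IsVisibleFromInfinity 𝒟.timeOrientation 𝒟.embed 𝒟.normal W₀ :=
    fun {_} ↦ isVisibleFromInfinity_chronologicalPast hvis₀
  -- (B): no cascade inside `W₀`, in the form consumed by the Zorn reduction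
  have hchain : ∀ P : ℕ → Set 𝒟.carrier, (∀ k, 𝒟.metric.IsTIP 𝒟.timeOrientation (P k)) →
      (∀ k, P k ⊆ W₀) → Antitone P →
        ∃ W, 𝒟.metric.IsTIP 𝒟.timeOrientation W ∧ ∀ k, W ⊆ P k := by
    intro P hP hPW hanti
    obtain ⟨γ, s, hs, hγ, he, hsub⟩ :=
      (hB X D hD 𝒟 hmax W₀ hW₀ hW₀vis P hP hPW hanti).resolve_left hex
    exact exists_isTIP_subset_of_isFutureEndless hP hs hγ he hsub
  -- Zorn on TIPs + countable coinitiality: a minimal TIP inside `W₀`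
  obtain ⟨W, hWW₀, hmin⟩ :=
    cauchyDevelopment_exists_isMinimalTIP_subset_of_seq 𝒟.toCauchyDevelopment hW₀ hchain
  -- which is visible (antitonicity), hence a first naked point of `𝒟`
  have hfirst : 𝒟.toCauchyDevelopment.FirstNakedPoint W :=
    fun {_} ↦ hmin.isFirstNakedPoint (hW₀vis.mono hWW₀)
  -- (C): blow up at `W`
  obtain ⟨Z, hZ, htan⟩ := (hC X D hD 𝒟 hmax W hfirst).resolve_left hex
  exact ⟨W, hfirst, Z, hZ, htan⟩

end Summit.FinalStateConjecture.FinalStateConjecture.Theorems
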